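import Summits.BirchSwinnertonDyer.BirchSwinnertonDyer.Theses.PrintX8VS
import Summits.BirchSwinnertonDyer.BirchSwinnertonDyer.Theorems.SignedLowerHalvesSprungLowerDivisibilityAtThreeIotaDoorStubs
import Literature.NumberTheory.EllipticCurves.Sprung2012.SharpFlatKatoDivisibility
import Literature.NumberTheory.EllipticCurves.Sprung2012.SharpFlatSelmer
import Literature.NumberTheory.EllipticCurves.ModularCurvePeriodRatio
import HarnessLib

/-!
# Line `ledger-door` v3 = the `ι`-DOOR for crux C1′ `KatoFineLowerSporadicX8` (item stmt-BirchSwinnertonDyer-22569, route `PrintX8VS` rev 12) — skeleton v3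

Written by the LEAD of the parent crux 19875 `SprungLowerDivisibilityAtThree` (line `chromatic-common-zeros`, lead g5, 2026-08-28),
whose skeleton v9 makes the x8 children its stubs BY NAME. NOTHING HERE PROVES ANYTHING: the crux, K1, leaf X8 and BSD are NOT proved.

THE LINE (v3 = the `ι`-RE-CUT of v2's off-`(T)` ledger door; STUB-PLAN-stub_katoFineLowerSporadic.md v3 §C′ R1–R3 / §D′ Rank 2,
crux dir of 19875). v2 composed the crux from F-α «`j(𝔭) ≤ x(𝔭)`» (cokernel bound, same prime) and R «`k ≤ x` on `{j < k}`»
through `ChromaticCommonZeros.stubs_offT_of_ledgerDoor` (p651820). The critic (v2 §C, v3 §C′) showed that the print cokernel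
bound — joint Coleman cokernel `Λ/(T)` + Poitou–Tate + `char tors X_{p^∞} = char(X₀)^ι` (Wingberg/Matar) — reads in the
tree's typed currency (the stub's `Y` is `γ`-keyed) as **F-α♮ «`j(𝔭) ≤ x(ι𝔭)`»**, `ι𝔭 := PrimeSpectrum.comap (invol p) 𝔭`, and
that the same-prime F-α is not available for the ∀-bound package at `ι`-moved (sporadic) primes. v3 therefore carries the
bound WITH ITS `ι` and composes through the **`ι`-DOOR** (`ChromaticCommonZeros.stubs_offT_of_iotaDoor`, LEAD g5): F-α♮ read AT
`ι𝔭` says `j(ι𝔭) ≤ x(𝔭)`, so `k(𝔭) ≤ x(𝔭)` at every common zero with `k(𝔭) ≤ j(ι𝔭)` (if `ι𝔭` is not a common zero,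
`j(ι𝔭) = 0` by `m = k + c`); the rest is the `ι`-residue **R♮ «`k ≤ x` on `{j(ι𝔭) < k(𝔭)}`»** — contained in the critic's
R_orb (the orbit door `k ≤ j ≤ x' ≤ k' ≤ j'` lands inside the `ι`-door) and EQUAL to v2's R at every `ι`-fixed prime (all
positive-level cyclotomic primes: `comap_invol_eq_self_of_cyclotomic_comp_mem`, w3 g6). THE SAME THREE STUBS (identical
names and signatures) are registered on the three x8 children 22569 / 22901 / 22570, so ONE typing of F-α♮ and ONE residue
statement close the whole off-`(T)` part of K1; the `(T)`-cell is S4a (landed, `r_an ≤ 1`) resp. S4b-T (`r_an ≥ 2`, idle,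
child 22570 only).
* stub F-α♮ `stub_cokerBoundIotaOffT` — the cokernel bound at the mirror prime (IN PRINT; (SES-KP) largely IN TREE: p653370,
  p654902, p655403 mod (IND), `…JointLinearProofs`; Poitou–Tate and Wingberg/Matar to TYPE; M to type, XL to prove);
* stub S5c `stub_heldFacts` — `h714 ∧ h716 ∧ h3` (citation-borne; conjuncts of x8's held binders);
* stub R♮ `stub_katoFineLowerResidueIotaOffT (h714) (h716) (h3)` — `k ≤ x` on `{j(ι𝔭) < k(𝔭)}` off `(T)` behind the R0
  fact binders (research; signed main conjecture ⊆ there; OPEN in print at `(3, a₃ = ±3)`).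

CLASS-WIDE RESIDUE after F-α♮ is typed: R♮. Per-pair doors in the tree (all `--supports 19875`): vacuity from chromatic
coprimality (p614828; x8 R5 certificates), simple-zero door (p648387), cyclotomic certificates (`…CyclotomicCertDoor`,
`…BirchCert` p623922), Eisenstein rigidity / robust Bézout / self-coprimality / ι-rigidity families (REPORT-v4 §2 of the parent
line), ι-symmetry of the ledger (`…LedgerIota` p650141, `…LedgerOrbit`), λ-budget socket (`…LedgerLambda` p650544/p650879).

KEYING (NEW, 2026-08-28T18:3xZ — x8 lit g52 T67 answering ref g23 R-228 ASK-1′: **P5 TRUE**): in print `Col^•(z_Kato) = (L♯, L♭)`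
VERBATIM (no `ι`), while the tree keys the duals `SharpFlatSelmerDualData W κ γ …` / `FineSelmerDualData κ γ` by PRE-composition
with the covariant action (`toDual_T_smul`), i.e. as the `ι`-TWISTS of the natural (contragredient) duals of print's sequence (3):
`ℓ_𝔭 D.X = ℓ_{ι𝔭} X^•_print`, `ℓ_𝔭 Y.X = ℓ_{ι𝔭} X₀_print`. Consequences recorded by the referee / lit (R-228 §2–§3, T67 (j3)/(m)),
NOT claims of this file: the typed package facts `thm714seq_sharpFlatColemanKato_zeta[Joint]` (hJ, conjunct of 22571) and
`thm716_…` (h716, inside `stub_heldFacts`) are FALSE AS TYPED at every X8 pair with a private sporadic zero, so at those pairs the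
∀-binders `I, Cs, Cf, Cs.Z = Cf.Z` below range over NOTHING in nature (the stubs are vacuous there and undischargeable through
held inputs); ALL sporadic-prime content of this line is keying-exposed until the Literature re-typing (contragredient `γ⁻¹` duals
in `SharpFlatColemanKatoData.exact`, h716, and the parent leaf `Theorems.SprungSharpFlatLowerDivisibility`, which shares h716's
binders word for word — LEAD g5 memo `Lines/chromatic-common-zeros-KEYING-g5.md`) lands; the positive-level cyclotomic content
(22901) is keying-immune as a statement. The `ι`-door's SHAPE survives the repair: in natural keying F-α still reads
`j(𝔭) ≤ x₀(ι𝔭)` because the `ι` of Wingberg/Matar `char tors X_{p^∞} = char(X₀)^ι` is print, so `stubs_offT_of_iotaDoor` is the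
composition in either keying (with `Y` replaced by the natural `γ⁻¹`-keyed fine datum after the repair).
-/

set_option linter.dupNamespace false
set_option autoImplicit false

noncomputable section

open scoped Classical NumberField MatrixGroups ModularForm

open NumberField IsDedekindDomain CongruenceSubgroup WeierstrassCurve Field
  Literature.NumberTheory.EllipticCurves Literature.NumberTheory.EllipticCurves.ModularForms
  Literature.NumberTheory.EllipticCurves.ZpExtension Literature.NumberTheory.EllipticCurves.Sprung2017
  Literature.NumberTheory.EllipticCurves.Sprung2012 Literature.NumberTheory.EllipticCurves.Rank1Residual
  Literature.NumberTheory.EllipticCurves.IwasawaAlgebra Literature.NumberTheory.EllipticCurves.Kato2004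
  Literature.NumberTheory.EllipticCurves.Module
  Summit.BirchSwinnertonDyer.BirchSwinnertonDyer.Theorems

namespace Summit.BirchSwinnertonDyer.BirchSwinnertonDyer.Cruxes.KatoFineLowerSporadicX8

namespace IotaDoor

/-! ## The stubs (shared verbatim by the line skeletons v3 of 22569, 22901 and 22570) -/

/-- **stub F-α♮ — THE COKERNEL BOUND OFF `(T)`, CARRIED AT THE MIRROR PRIME** (package currency; = hypothesis `hFα` of
`ChromaticCommonZeros.stubs_offT_of_iotaDoor` / `katoFineLowerOffT_of_iotaDoor` VERBATIM, files `…IotaDoor[Stubs]`, LEAD g5;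
SHARED verbatim by the line skeletons v3 of the three x8 children 22569 `KatoFineLowerSporadicX8`, 22901
`CyclotomicLowerPosLevelX8`, 22570 `CyclotomicLowerRestX8R` — ONE typing closes it on all three). Over the crux's own binders
(class X8, cyclotomic/Honda setting, newform and Sprung pair, the joint ♯/♭ Coleman–Kato package `I, Cs, Cf` with
`Cs.Z = Cf.Z`, a `γ`-keyed fine dual datum `Y`), at a height-one `𝔭` with `(p : Λ) ∉ 𝔭`, `T ∉ 𝔭`, at which every colour's
Néron-normalised `L`-function vanishes: `min(ℓ_𝔭 Λ/range Cs.colMap, ℓ_𝔭 Λ/range Cf.colMap) ≤ ℓ_{ι𝔭} Y.X`,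
`ι𝔭 := PrimeSpectrum.comap (invol p) 𝔭` («local index at `𝔭` ≤ fine mass at the mirror prime»). = skeleton v2's F-α
`stub_cokerBoundOffT` with ONLY the prime of the right-hand side changed (STUB-PLAN-stub_katoFineLowerSporadic v3 §C′ R1: the
same-prime F-α is not available for the ∀-bound package at `ι`-moved primes, v2 §C; F-α♮ is the typed reading of the print
composite and is branch-independent, R3). At every `ι`-FIXED prime — `(T)`, `(p)`, every positive-level cyclotomic prime
(`ChromaticCommonZeros.comap_invol_eq_self_of_cyclotomic_comp_mem`) — F-α♮ = F-α. IN PRINT as a composite, each step exact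
(x8 lit T63 (c)): (SES-KP)♯♭ — the joint Coleman map `(Col♯, Col♭) : H¹_Iw(ℚ_p, T) → Λ²` is injective (IN TREE:
`Sprung2012/ColemanMapJointInjectiveProofs`, p653370) with `T·Λ² ⊆ image` (IN TREE modulo the rank clause (IND):
`Sprung2012/ColemanMapJointCokernelProofs`, p655403; Lei–Sujatha 2021 §3; Kurihara–Pollack 2007 Prop. 1.2 for `a_p = 0`), hence
an isomorphism at every height-one `𝔭 ≠ (T)`; Poitou–Tate `0 → 𝐇¹ → H¹_Iw(ℚ_p, T) → X_{p^∞}(E/ℚ_∞) → X₀ → 0` (Kato (17.13.1);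
Kobayashi 2003 Thm. 7.3), so `tors(H¹_Iw ⧸ loc 𝐇¹) ↪ tors X_{p^∞}` with `ℓ_𝔭 tors(H¹_Iw ⧸ loc 𝐇¹) = j_gen(𝔭)` (`𝐇¹` free of
rank one, Kato Thm. 12.4 (3)); `char tors_Λ X_{p^∞} = char(X₀)^ι` (Wingberg 1989 Cor. 2.5 / Matar 2020 Thm. 1.1) — this `ι` is
the one displayed; then the dictionary to the package's `colMap` and the `γ`-keyed `Y` (STUB-PLAN v3 §C′ R3: (PT^•) per colour,
Sprung Thm. 7.14 (3), and the ♯/♭ twin H1a of `Kato2004.fineSelmerDualData_lengthAt_inv_eq`). Pure-algebra skeleton of the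
length bookkeeping: `ChromaticCommonZeros.min_lengthAt_quotient_range_le_lengthAt_torsion_of_skeleton` (p652444). HELD-INPUT
grade once typed (M to type, XL to prove from Mathlib). Why it might fail as typed: a side condition of the Poitou–Tate step at
`𝔭` (Tate lines `𝔭 = (1 + T − u^{±1})`, local `H²` at split multiplicative primes) — then restrict F-α♮ off that set and
enlarge the residue by it (`stub_katoFineLowerSporadic_of_ledgerDoor_off` pattern, p648498).
[cite: LeiSujatha2021, §3 (SES-KP), (PT)] [cite: KuriharaPollack2007, Prop. 1.2] [cite: Sprung2012, §7.1 Def. 7.1, Props. 7.3/7.6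
(p. 1500–1501), Thm. 7.14 (3) (p. 1504)] [cite: Kato2004Asterisque, Thm. 12.4 (p. 221), §17.13 (17.13.1) (p. 279–280)]
[cite: Kobayashi2003, Thm. 7.3] [cite: Wingberg1989, Cor. 2.5] [cite: Matar2020, Thm. 1.1] [cite: Greenberg1989, §0] -/
theorem stub_cokerBoundIotaOffT :
∀ (W : WeierstrassCurve ℚ) [W.IsElliptic] [W.IsGloballyMinimal] (p : ℕ) [Fact p.Prime]
      [ContinuousSMul ℤ_[p] (W.tateModule p)] [Module.Free ℤ_[p] (W.tateModule p)]
      [Module.Finite ℤ_[p] (W.tateModule p)],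
      ClassX8 W p → ∀ (κ : ZpExtension ℚ p) (γ : Field.absoluteGaloisGroup ℚ),
      κ.IsCyclotomic → κ.IsTopGenerator γ → IsCyclotomicVariable p γ →
    ∀ (v : HeightOneSpectrum (𝓞 ℚ)), (p : 𝓞 ℚ) ∈ v.asIdeal →
    ∀ (g : Field.absoluteGaloisGroup (v.adicCompletion ℚ)),
      κ.IsTopGenerator (resGalOfEmb (closureEmb (K := ℚ) (v.adicCompletion ℚ)) g) →
    ∀ (cneg : localPoints W (v.adicCompletion ℚ)) (c : ℕ → localPoints W (v.adicCompletion ℚ)),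
      IsHondaSystem κ (closureEmb (K := ℚ) (v.adicCompletion ℚ)) W (W.frobeniusTrace p) g cneg c →
    ∀ (N : ℕ) (_ : NeZero N) (f : CuspForm (Gamma0 N) 2) (ϖ : ℚ) (Lsharp Lflat : IwasawaAlgebra p),
      IsNewformOf W f → (ϖ : ℝ) * W.realPeriodRat = plusPeriod f →
      IsSprungPair f p (W.frobeniusTrace p) Lsharp Lflat →
    ∀ (I : Kato2004.IwasawaH1Data W p κ γ)
      (Cs : SharpFlatColemanKatoData W p f ϖ κ γ (closureEmb (K := ℚ) (v.adicCompletion ℚ))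
        (W.frobeniusTrace p) g c Chroma.sharp I)
      (Cf : SharpFlatColemanKatoData W p f ϖ κ γ (closureEmb (K := ℚ) (v.adicCompletion ℚ))
        (W.frobeniusTrace p) g c Chroma.flat I),
      Cs.Z = Cf.Z →
    ∀ (Y : W.FineSelmerDualData κ γ) (𝔭 : PrimeSpectrum (IwasawaAlgebra p)), 𝔭.asIdeal.height = 1 →
      (p : IwasawaAlgebra p) ∉ 𝔭.asIdeal → (PowerSeries.X : IwasawaAlgebra p) ∉ 𝔭.asIdeal →
      (∀ (col' : Chroma) (G' : IwasawaAlgebra p),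
        iwasawaToPowerSeries p G' =
          PowerSeries.C (ϖ : ℚ_[p]) * iwasawaToPowerSeries p (chromaticL col' Lsharp Lflat) →
        G' ∈ 𝔭.asIdeal) →
      min (Module.lengthAt (IwasawaAlgebra p) (IwasawaAlgebra p ⧸ LinearMap.range Cs.colMap) 𝔭)
          (Module.lengthAt (IwasawaAlgebra p) (IwasawaAlgebra p ⧸ LinearMap.range Cf.colMap) 𝔭) ≤
        Module.lengthAt (IwasawaAlgebra p) Y.X (PrimeSpectrum.comap (invol p).toRingHom 𝔭) := by
  sorry

/-- **stub S5c — held facts for the residue** (citation-borne, size S; closes by conjunction introduction once the facts are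
`_holds`; SHARED by the three child skeletons; unchanged from v2): Sprung 2012 Thm. 7.14 (`X^•` f.g. torsion when `L^• ≠ 0`),
Thm. 7.16 (Kato's divisibility in ♯/♭ currency `∃ n, pⁿ L^• ∈ char X^•`; typed fact
`Sprung2012.thm716_sharpFlatCharIdeal_divisibility`), and the period unit at 3 (⟸ Mazur Cor. 4.1,
`realPeriodRat_eq_unit_mul_plusPeriod_three_of_mazur`). All three are conjuncts of x8's held closes-binders
(`PublishedInputsX8Core` (4),(5); `HeldInputsX8R` (ii)). [cite: Sprung2012, Thm. 7.14 and Thm. 7.16 (p. 1504)]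
[cite: Kato2004Asterisque, Thm. 12.5 (p. 222)] [cite: GreenbergVatsal2000, Rem. 3.4] [cite: Mazur1978, Cor. 4.1] -/
theorem stub_heldFacts :
    thm714_sharpFlatSelmerDual_finite_torsion ∧ thm716_sharpFlatCharIdeal_divisibility ∧
      realPeriodRat_eq_unit_mul_plusPeriod_three := by
  sorry

/-- **stub R♮ — THE `ι`-RESIDUE OFF `(T)`: Kato's fine inequality `k ≤ x` at `𝔭` where the local index at the MIRROR prime is
below the zeta index, `j(ι𝔭) < k(𝔭)`** (= hypothesis `hres` of `ChromaticCommonZeros.stubs_offT_of_iotaDoor` VERBATIM, behind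
the STUB-PLAN R0 fact binders `h714`, `h716`, `h3`; SHARED verbatim by the three child skeletons v3). Over the crux's binders, at
a height-one `𝔭` with `(p : Λ) ∉ 𝔭`, `T ∉ 𝔭`, a common zero of every normalised colour, with
`min(ℓ_{ι𝔭} Λ/range Cs.colMap, ℓ_{ι𝔭} Λ/range Cf.colMap) < ℓ_𝔭(I.H ⧸ Cs.Z)`: `ℓ_𝔭(I.H ⧸ Cs.Z) ≤ ℓ_𝔭 Y.X`. The complement
`{k(𝔭) ≤ j(ι𝔭)}` is the `ι`-DOOR (`ChromaticCommonZeros.katoFineLowerAt_of_iotaDoor`: F-α♮ at `ι𝔭` gives `j(ι𝔭) ≤ x(𝔭)`),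
which contains the ledger door `{k ≤ j}` of v2 at `ι`-fixed primes and the critic's orbit door (STUB-PLAN v3 §C′ R2) everywhere
(`zeta_le_localIndex_comap_invol_of_orbitDoor`); so R♮ ⊆ R_orb, and R♮ = v2's R at the positive-level cyclotomic primes.
Research; = the Eisenstein (⊆) half of Kato 2004 Conj. 12.10 / Sprung 2012 Main Conj. 7.21 at those primes — SPORADIC (item
22569) and POSITIVE-LEVEL CYCLOTOMIC (item 22901, the exceptional twisted zeros `L(E, χ, 1) = 0`) alike; OPEN in print at
`(3, a₃ = ±3)` (BSTW 2024: `a_p = 0`; Kim 2026: `p ≥ 5`; Lei–Sujatha 2021 Thm. 1.2 assumes Kato's main conjecture).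
Conjecturally EMPTY on the sporadic side (Kurihara–Pollack Problem 3.2 / Sprung 2015 Conj. 5.6: no sporadic common zeros; note
the hypothesis forces `k(𝔭) ≥ 1`, i.e. `𝔭` is a zero of BOTH colours with positive zeta index) and Rohrlich-finite per curve on
the cyclotomic side (none on the 217-cell census). With the binders in scope: `h716` gives `x ≤ k` off `(3)`
(`fine_le_zeta_of_pow_mul_mem_charIdeal`, p648387), the DEFECT ELEMENT `j_def ≠ 0` with `k = x + ℓ_𝔭 Λ/(j_def)`
(`ClassX8.exists_katoSporadicDefect`), so R♮ ⟺ «`j_def` has no prime factor inside `{j(ι𝔭) < k(𝔭)}` off `(T)`»; and Kato's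
bound at the mirror prime `x(ι𝔭) ≤ k(ι𝔭)` (`ClassX8.fine_le_zeta_le_of_chromaticL_ne_zero` at `ι𝔭`,
`comap_invol_heightOne_not_mem`). Why it might fail: only through a failure of the signed main conjecture at such a prime of an
X8 curve. [cite: Kato2004Asterisque, Conj. 12.10 (p. 224), Thm. 12.5 (p. 222)] [cite: Sprung2012, Thm. 7.16 (p. 1504), Prop. 7.19
and Main Conj. 7.21 (p. 1505)] [cite: KuriharaPollack2007, Problem 3.2, Thm. 1.3] [cite: Sprung2015, Conj. 5.6]
[cite: LeiSujatha2021, Thm. 1.2] [cite: Rohrlich1984, Thm.] -/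
theorem stub_katoFineLowerResidueIotaOffT (h714 : thm714_sharpFlatSelmerDual_finite_torsion)
    (h716 : thm716_sharpFlatCharIdeal_divisibility) (h3 : realPeriodRat_eq_unit_mul_plusPeriod_three) :
∀ (W : WeierstrassCurve ℚ) [W.IsElliptic] [W.IsGloballyMinimal] (p : ℕ) [Fact p.Prime]
      [ContinuousSMul ℤ_[p] (W.tateModule p)] [Module.Free ℤ_[p] (W.tateModule p)]
      [Module.Finite ℤ_[p] (W.tateModule p)],
      ClassX8 W p → ∀ (κ : ZpExtension ℚ p) (γ : Field.absoluteGaloisGroup ℚ),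
      κ.IsCyclotomic → κ.IsTopGenerator γ → IsCyclotomicVariable p γ →
    ∀ (v : HeightOneSpectrum (𝓞 ℚ)), (p : 𝓞 ℚ) ∈ v.asIdeal →
    ∀ (g : Field.absoluteGaloisGroup (v.adicCompletion ℚ)),
      κ.IsTopGenerator (resGalOfEmb (closureEmb (K := ℚ) (v.adicCompletion ℚ)) g) →
    ∀ (cneg : localPoints W (v.adicCompletion ℚ)) (c : ℕ → localPoints W (v.adicCompletion ℚ)),
      IsHondaSystem κ (closureEmb (K := ℚ) (v.adicCompletion ℚ)) W (W.frobeniusTrace p) g cneg c →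
    ∀ (N : ℕ) (_ : NeZero N) (f : CuspForm (Gamma0 N) 2) (ϖ : ℚ) (Lsharp Lflat : IwasawaAlgebra p),
      IsNewformOf W f → (ϖ : ℝ) * W.realPeriodRat = plusPeriod f →
      IsSprungPair f p (W.frobeniusTrace p) Lsharp Lflat →
    ∀ (I : Kato2004.IwasawaH1Data W p κ γ)
      (Cs : SharpFlatColemanKatoData W p f ϖ κ γ (closureEmb (K := ℚ) (v.adicCompletion ℚ))
        (W.frobeniusTrace p) g c Chroma.sharp I)
      (Cf : SharpFlatColemanKatoData W p f ϖ κ γ (closureEmb (K := ℚ) (v.adicCompletion ℚ))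
        (W.frobeniusTrace p) g c Chroma.flat I),
      Cs.Z = Cf.Z →
    ∀ (Y : W.FineSelmerDualData κ γ) (𝔭 : PrimeSpectrum (IwasawaAlgebra p)), 𝔭.asIdeal.height = 1 →
      (p : IwasawaAlgebra p) ∉ 𝔭.asIdeal → (PowerSeries.X : IwasawaAlgebra p) ∉ 𝔭.asIdeal →
      (∀ (col' : Chroma) (G' : IwasawaAlgebra p),
        iwasawaToPowerSeries p G' =
          PowerSeries.C (ϖ : ℚ_[p]) * iwasawaToPowerSeries p (chromaticL col' Lsharp Lflat) →
        G' ∈ 𝔭.asIdeal) →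
      min (Module.lengthAt (IwasawaAlgebra p) (IwasawaAlgebra p ⧸ LinearMap.range Cs.colMap)
            (PrimeSpectrum.comap (invol p).toRingHom 𝔭))
          (Module.lengthAt (IwasawaAlgebra p) (IwasawaAlgebra p ⧸ LinearMap.range Cf.colMap)
            (PrimeSpectrum.comap (invol p).toRingHom 𝔭)) <
          Module.lengthAt (IwasawaAlgebra p) (I.H ⧸ Cs.Z) 𝔭 →
      Module.lengthAt (IwasawaAlgebra p) (I.H ⧸ Cs.Z) 𝔭 ≤ Module.lengthAt (IwasawaAlgebra p) Y.X 𝔭 := by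
  sorry


/-! ## The composition (sorry-free): C1′ BY NAME = the sporadic conjunct of the `ι`-door -/

/-- **THE SKELETON**: the crux decl `PrintX8VS.KatoFineLowerSporadicX8` (item 22569) BY NAME, no hypotheses, from the stubs
(a sporadic prime contains no `ω_n`, in particular not `ω_0 = T`). -/
theorem KatoFineLowerSporadicX8_of :
    Summit.BirchSwinnertonDyer.BirchSwinnertonDyer.Theses.PrintX8VS.KatoFineLowerSporadicX8 := by
  obtain ⟨h714, h716, h3⟩ := stub_heldFacts
  intro W _ _ p _ _ _ _ hX
  exact (ChromaticCommonZeros.stubs_offT_of_iotaDoor stub_cokerBoundIotaOffT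
    (stub_katoFineLowerResidueIotaOffT h714 h716 h3)).1 W p hX

end IotaDoor

end Summit.BirchSwinnertonDyer.BirchSwinnertonDyer.Cruxes.KatoFineLowerSporadicX8

end
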